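import Summits.BirchSwinnertonDyer.BirchSwinnertonDyer.Theorems.InertBadSignedBranchesCccOneLawOnTypeIstarZeroCollinearMuAdmissible
import Summits.BirchSwinnertonDyer.BirchSwinnertonDyer.Theorems.InertBadSignedBranchesCccOneLawOnTypeIstarZeroMuDictionaryEta
import HarnessLib

set_option linter.dupNamespace false
set_option autoImplicit false

/-!
# Route `InertBadSignedBranches` (rung K8), crux 19223 `CccOneLawOnTypeIstarZero`, line `kato_perrin_riou_istar`:
# stub 2b IS «`μ(Col⁺(loc z₀)) = μ(L_p⁺(V, η, X))`» in the `η`-frame, granted 19867 + 19865 (helper `--supports stmt-BirchSwinnertonDyer-19223`)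

HONEST FRAMING (refill hand `leafhand-bsd-inertbadsignedbran-4`, LAND-ONLY): BSD is NOT proved by any of this; nothing
here closes a stub, an item or a cell; no definition, no new fact, no `sorry`; nothing is booked.

WHAT.  Composition BY NAME of hand -3's `μ`-dictionary (`CccOneMuDictionaryEta.lengthAt_contra_fine_eq_lengthAt_quotient_of_plusMCEtaKMuPart`:
granted 19867 `PublishedInputsEtaUpToP` and 19865 `PlusMCEtaKMuPart`, `length_(p) Y.X = length_(p) (𝐇¹_Γ ⧸ Λ∙P.z)` for every
contragredient `Y` and every Kobayashi package `P`) with this hand's Coleman-image form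
(`CccOneCollinearMu.zcMu_iff_lengthAt_colPlus`).  RESULT, in the common `η`-frame of items 19501/19865 (section variables =
hand -3's, verbatim) and for every twist datum `W` (globally minimal) with pins `I`, `FB`, every package `P`, every
contragredient `Y : W.FineSelmerDualData κ γ⁻¹` and every ADMISSIBLE `z₀`:
**the sentence of RESEARCH stub 2b `KatoPerrinRiouIstar.stub_katoMuEqualityIstarZero` at `(κ, γ, I, z₀, Y, (p))`,
`length_(p) Y.X = length_(p) (𝐇¹_Γ ⧸ Λ∙z₀)`, holds IFF `length_(p) (Λ ⧸ (P.colPlus z₀)) = length_(p) (Λ ⧸ (P.colPlus P.z))`**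
— the `μ`-invariant of the plus-Coleman image of Kato's `Ω_W`-normalised zeta class of `W` equals `μ(L_p⁺(V, η, X))`
(`P.colPlus P.z` is a plus function, `P.isPlus_colPlus_z`; §6a keys the right side to ANY `Lp` with Kobayashi's interpolation
property, `IsQuadraticBranchPlusLFunction.span_singleton_eq` — so it reads `length_(p) (Λ ⧸ (P.colPlus z₀)) = length_(p) (Λ ⧸ (Lp))`);
the same through `P.colMinus`; and the same keyed to the
registered ROUTE-CRUX stub 6a `PlusMCEtaK` (19501) instead of its `μ`-part (via `PlusMCEtaKUpToMu.plusMCEtaK_iff_muInvariant_eq_of_burungaleTian`).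
So, granted the line's other named inputs, stub 2b in the `η`-frame keying is ONE equality of `μ`-invariants of two power
series, both images of classes of the SAME pin under the SAME injective Coleman functional — NOT asserted here.  (Stub 2b's other
keyings `(K, γ′)` reduce to this one by hand -3's `…MuDictionaryEtaKeying` §1–§2; its `∀ admissible z₀` to `∃` by
`CccOneCollinearMu.forall_admissible_lengthAt_eq_of_exists` modulo ★.)

References: [Kobayashi2003] Thm. 6.3 (p. 11), Thm. 7.3 i) (7.21) and proof of Thm. 7.4 (p. 13); [Kato2004Asterisque] Thm. 12.5 (1)
(p. 221), Conj. 12.10 (p. 224); [BurungaleTian2026] Thm. 2.6, Rem. 2.7 (p. 5); [Washington1997] §13.2.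
-/

noncomputable section

open scoped Classical

open CongruenceSubgroup WeierstrassCurve Field Literature.NumberTheory.EllipticCurves
  Literature.NumberTheory.EllipticCurves.ModularForms Literature.NumberTheory.GaloisRepresentations
  Literature.NumberTheory.EllipticCurves.Module Literature.NumberTheory.EllipticCurves.Kato2004
  ZpExtension Summit.BirchSwinnertonDyer.Rank1Residual
  Summit.BirchSwinnertonDyer.BirchSwinnertonDyer.Theses.InertBadSignedBranches
  Summit.BirchSwinnertonDyer.BirchSwinnertonDyer.Theorems.CccOneMuDictionaryEta

namespace Summit.BirchSwinnertonDyer.BirchSwinnertonDyer.Theorems.CccOneCollinearMu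

variable {p : ℕ} [Fact p.Prime]

/-! ## §6a Keyed to Kobayashi's `L_p⁺(V, η, X)` itself (any solution of his interpolation property; the ideal is choice-free) -/

section PlusFunction

variable {K₀ : Type} [Field K₀] [NumberField K₀] [(galRange (K := ℚ) K₀).Normal]
  {η : absoluteGaloisGroup ℚ →* ℤˣ} {V : WeierstrassCurve ℚ} [V.IsElliptic] {N : ℕ} {f : CuspForm (Gamma0 N) 2}
  {ϖ : ℚ} {κ : ZpExtension ℚ p} {γ : absoluteGaloisGroup ℚ} {W : WeierstrassCurve ℚ} [W.IsElliptic]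
  [W.IsGloballyMinimal] [ContinuousSMul ℤ_[p] (W.tateModule p)] {I : IwasawaH1Data W p κ γ}
  {FB : W.FineSelmerDualData κ γ} {hκ : κ.IsCyclotomic}

/-- **«ZC-μ» ⟺ `μ(Col⁺(loc z₀)) = μ(L_p⁺(V, η, X))` for EVERY `Lp` with Kobayashi's interpolation property (3.4)+(3.6) at `η`**
(`Kobayashi2003.IsQuadraticBranchPlusLFunction f p ϖ Lp`; the ideal `(Lp)` is choice-free,
`IsQuadraticBranchPlusLFunction.span_singleton_eq`, and equals `(P.colPlus P.z)` by `P.isPlus_colPlus_z`): for a Kobayashi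
package `P`, an admissible `z₀` and `𝔮 = (p)`,
`length_𝔮 (𝐇¹_Γ ⧸ Λ∙z₀) = length_𝔮 (𝐇¹_Γ ⧸ Λ∙P.z) ↔ length_𝔮 (Λ ⧸ (P.colPlus z₀)) = length_𝔮 (Λ ⧸ (Lp))`.
[cite: Kobayashi2003, (3.4)–(3.6) (p. 7), §4 (p. 8), Thm. 6.3 (p. 11), Thm. 7.3 i) (p. 13)] [cite: Kato2004Asterisque, Conj. 12.10 (p. 224)] -/
theorem zcMu_iff_lengthAt_colPlus_eq_lengthAt_plusLFunction
    (P : Kobayashi2003.EtaColemanPoitouTateData p K₀ η V f ϖ κ γ W I FB) (hp : p ≠ 2)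
    (hγ : κ.IsTopGenerator γ) {z₀ : I.H} (h₀ : IsAdmissibleZetaClass W p κ hκ I z₀) {Lp : IwasawaAlgebra p}
    (hLp : Kobayashi2003.IsQuadraticBranchPlusLFunction f p ϖ Lp)
    (𝔮 : PrimeSpectrum (IwasawaAlgebra p)) (h𝔮 : 𝔮.asIdeal = IwasawaAlgebra.augIdealP p) :
    Module.lengthAt (IwasawaAlgebra p) (I.H ⧸ (IwasawaAlgebra p) ∙ z₀) 𝔮 =
        Module.lengthAt (IwasawaAlgebra p) (I.H ⧸ (IwasawaAlgebra p) ∙ P.z) 𝔮 ↔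
      Module.lengthAt (IwasawaAlgebra p) (IwasawaAlgebra p ⧸ Ideal.span {P.colPlus z₀}) 𝔮 =
        Module.lengthAt (IwasawaAlgebra p) (IwasawaAlgebra p ⧸ Ideal.span {Lp}) 𝔮 := by
  have hspan : Ideal.span {P.colPlus P.z} = Ideal.span {Lp} :=
    Kobayashi2003.IsQuadraticBranchPlusLFunction.span_singleton_eq hp P.isPlus_colPlus_z hLp
  rw [zcMu_iff_lengthAt_colPlus P hγ h₀ 𝔮 h𝔮, lengthAt_eq_of_linearEquiv (Submodule.quotEquivOfEq _ _ hspan) 𝔮]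

end PlusFunction

/-! ## §6 The `η`-frame (section variables = hand -3's `CccOneMuDictionaryEta`, verbatim) -/

section Frame

variable (hp : p ≠ 2) (K₀ : Type) [Field K₀] [NumberField K₀]
  [IsCyclotomicExtension {p} ℚ K₀] [(galRange (K := ℚ) K₀).Normal]
  (η : absoluteGaloisGroup ℚ →* ℤˣ) (hη : ∀ σ ∈ galRange (K := ℚ) K₀, η σ = 1) (hη1 : η ≠ 1)
  (V : WeierstrassCurve ℚ) [V.IsElliptic] [V.IsGloballyMinimal] {N : ℕ} [NeZero N]
  {f : CuspForm (Gamma0 N) 2} (hCM : V.HasCM) (hgood : V.HasGoodReductionAtPrime p)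
  (hap : V.frobeniusTrace p = 0) (hf : IsNewformOf V f) (ϖ : ℚ)
  (hϖ : if Even (p / 2) then (ϖ : ℝ) * V.realPeriodRat = plusPeriod f
    else (ϖ : ℝ) * V.imaginaryPeriodRat = minusPeriod f)
  (κ : ZpExtension ℚ p) (γ : absoluteGaloisGroup ℚ) (hκ : κ.IsCyclotomic) (hγ : κ.IsTopGenerator γ)
  (hγK : γ ∈ galRange (K := ℚ) K₀) (hvar : IsCyclotomicVariable p γ)
  (W : WeierstrassCurve ℚ) [W.IsElliptic] [W.IsGloballyMinimal] [ContinuousSMul ℤ_[p] (W.tateModule p)]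
  (I : Kato2004.IwasawaH1Data W p κ γ) (FB : W.FineSelmerDualData κ γ)
  (P : Kobayashi2003.EtaColemanPoitouTateData p K₀ η V f ϖ κ γ W I FB)

include hp hη hη1 hCM hgood hap hf hϖ hκ hγ hγK hvar

/-- **Stub 2b's sentence in the `η`-frame ⟺ «`μ(Col⁺(loc z₀)) = μ(Col⁺(loc P.z)) = μ(L_p⁺(V, η, X))`», granted 19867 + 19865.**
For every contragredient `Y : W.FineSelmerDualData κ γ⁻¹`, every admissible Kato zeta class `z₀` of the pin `I` and `𝔮 = (p)`:
`length_𝔮 Y.X = length_𝔮 (𝐇¹_Γ ⧸ Λ∙z₀) ↔ length_𝔮 (Λ ⧸ (P.colPlus z₀)) = length_𝔮 (Λ ⧸ (P.colPlus P.z))`.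
Kernel composition of hand -3's dictionary with `zcMu_iff_lengthAt_colPlus`; CONDITIONAL on the named inputs `hF`, `hμ` (open: 19865).
[cite: Kobayashi2003, Thm. 6.3 (p. 11), Thm. 7.3 i) and proof of Thm. 7.4 (p. 13)] [cite: Kato2004Asterisque, Conj. 12.10 (p. 224)]
[cite: BurungaleTian2026, Rem. 2.7 (p. 5)] -/
theorem stub2b_sentence_iff_lengthAt_colPlus_of_plusMCEtaKMuPart (hF : PublishedInputsEtaUpToP)
    (hμ : PlusMCEtaKMuPart) (Y : W.FineSelmerDualData κ γ⁻¹) {z₀ : I.H}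
    (h₀ : IsAdmissibleZetaClass W p κ hκ I z₀)
    (𝔮 : PrimeSpectrum (IwasawaAlgebra p)) (h𝔮 : 𝔮.asIdeal = IwasawaAlgebra.augIdealP p) :
    Module.lengthAt (IwasawaAlgebra p) Y.X 𝔮 =
        Module.lengthAt (IwasawaAlgebra p) (I.H ⧸ (IwasawaAlgebra p) ∙ z₀) 𝔮 ↔
      Module.lengthAt (IwasawaAlgebra p) (IwasawaAlgebra p ⧸ Ideal.span {P.colPlus z₀}) 𝔮 =
        Module.lengthAt (IwasawaAlgebra p) (IwasawaAlgebra p ⧸ Ideal.span {P.colPlus P.z}) 𝔮 := by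
  rw [lengthAt_contra_fine_eq_lengthAt_quotient_of_plusMCEtaKMuPart hp K₀ η hη hη1 V hCM hgood hap hf ϖ hϖ κ γ
      hκ hγ hγK hvar W I FB P hF hμ Y 𝔮 h𝔮, eq_comm]
  exact zcMu_iff_lengthAt_colPlus P hγ h₀ 𝔮 h𝔮

/-- **Stub 2b's sentence in the `η`-frame ⟺ `μ(Col⁺(loc z₀)) = μ(Lp)` for EVERY `Lp` with Kobayashi's interpolation property at `η`**
(granted 19867 + 19865): `length_𝔮 Y.X = length_𝔮 (𝐇¹_Γ ⧸ Λ∙z₀) ↔ length_𝔮 (Λ ⧸ (P.colPlus z₀)) = length_𝔮 (Λ ⧸ (Lp))` at `𝔮 = (p)` —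
literally «the `μ`-invariant of the plus-Coleman image of the admissible Kato class of `W` equals `μ(L_p⁺(V, η, X))`».
[cite: Kobayashi2003, (3.4)–(3.6) (p. 7), Thm. 6.3 (p. 11), Thm. 7.3 i) (p. 13)] [cite: Kato2004Asterisque, Conj. 12.10 (p. 224)]
[cite: BurungaleTian2026, Rem. 2.7 (p. 5)] -/
theorem stub2b_sentence_iff_lengthAt_colPlus_eq_lengthAt_plusLFunction (hF : PublishedInputsEtaUpToP)
    (hμ : PlusMCEtaKMuPart) (Y : W.FineSelmerDualData κ γ⁻¹) {z₀ : I.H}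
    (h₀ : IsAdmissibleZetaClass W p κ hκ I z₀) {Lp : IwasawaAlgebra p}
    (hLp : Kobayashi2003.IsQuadraticBranchPlusLFunction f p ϖ Lp)
    (𝔮 : PrimeSpectrum (IwasawaAlgebra p)) (h𝔮 : 𝔮.asIdeal = IwasawaAlgebra.augIdealP p) :
    Module.lengthAt (IwasawaAlgebra p) Y.X 𝔮 =
        Module.lengthAt (IwasawaAlgebra p) (I.H ⧸ (IwasawaAlgebra p) ∙ z₀) 𝔮 ↔
      Module.lengthAt (IwasawaAlgebra p) (IwasawaAlgebra p ⧸ Ideal.span {P.colPlus z₀}) 𝔮 =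
        Module.lengthAt (IwasawaAlgebra p) (IwasawaAlgebra p ⧸ Ideal.span {Lp}) 𝔮 := by
  rw [lengthAt_contra_fine_eq_lengthAt_quotient_of_plusMCEtaKMuPart hp K₀ η hη hη1 V hCM hgood hap hf ϖ hϖ κ γ
      hκ hγ hγK hvar W I FB P hF hμ Y 𝔮 h𝔮, eq_comm]
  exact zcMu_iff_lengthAt_colPlus_eq_lengthAt_plusLFunction P hp hγ h₀ hLp 𝔮 h𝔮

/-- **Minus-side form** of the same equivalence (through `X⁻¹Col⁻ ∘ loc`, `P.colMinus`; `X · P.colMinus P.z = L_p⁻(V, η, X)`).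
[cite: Kobayashi2003, Thm. 6.3 (p. 11), Thm. 7.3 i) (p. 13)] [cite: Kato2004Asterisque, Conj. 12.10 (p. 224)] -/
theorem stub2b_sentence_iff_lengthAt_colMinus_of_plusMCEtaKMuPart (hF : PublishedInputsEtaUpToP)
    (hμ : PlusMCEtaKMuPart) (Y : W.FineSelmerDualData κ γ⁻¹) {z₀ : I.H}
    (h₀ : IsAdmissibleZetaClass W p κ hκ I z₀)
    (𝔮 : PrimeSpectrum (IwasawaAlgebra p)) (h𝔮 : 𝔮.asIdeal = IwasawaAlgebra.augIdealP p) :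
    Module.lengthAt (IwasawaAlgebra p) Y.X 𝔮 =
        Module.lengthAt (IwasawaAlgebra p) (I.H ⧸ (IwasawaAlgebra p) ∙ z₀) 𝔮 ↔
      Module.lengthAt (IwasawaAlgebra p) (IwasawaAlgebra p ⧸ Ideal.span {P.colMinus z₀}) 𝔮 =
        Module.lengthAt (IwasawaAlgebra p) (IwasawaAlgebra p ⧸ Ideal.span {P.colMinus P.z}) 𝔮 := by
  rw [lengthAt_contra_fine_eq_lengthAt_quotient_of_plusMCEtaKMuPart hp K₀ η hη hη1 V hCM hgood hap hf ϖ hϖ κ γ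
      hκ hγ hγK hvar W I FB P hF hμ Y 𝔮 h𝔮, eq_comm]
  exact zcMu_iff_lengthAt_colMinus P hγ h₀ 𝔮 h𝔮

omit [W.IsGloballyMinimal] in
/-- **Sufficient unit form**: granted 19867 + 19865, if `Col⁺(loc z₀) = u · Col⁺(loc P.z)` for a unit `u` of `Λ` (equivalently
`z₀ = u • P.z`, `eq_smul_iff_apply_eq_mul`), then stub 2b's sentence holds at `(κ, γ, I, z₀, Y, (p))`.
[cite: Kobayashi2003, Thm. 7.3 i) (p. 13)] [cite: Kato2004Asterisque, Conj. 12.10 (p. 224)] -/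
theorem stub2b_sentence_of_colPlus_eq_units_mul (hF : PublishedInputsEtaUpToP) (hμ : PlusMCEtaKMuPart)
    (Y : W.FineSelmerDualData κ γ⁻¹) {z₀ : I.H} {u : (IwasawaAlgebra p)ˣ}
    (hu : P.colPlus z₀ = (u : IwasawaAlgebra p) * P.colPlus P.z)
    (𝔮 : PrimeSpectrum (IwasawaAlgebra p)) (h𝔮 : 𝔮.asIdeal = IwasawaAlgebra.augIdealP p) :
    Module.lengthAt (IwasawaAlgebra p) Y.X 𝔮 =
      Module.lengthAt (IwasawaAlgebra p) (I.H ⧸ (IwasawaAlgebra p) ∙ z₀) 𝔮 := by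
  have hz : z₀ = (u : IwasawaAlgebra p) • P.z :=
    (eq_smul_iff_apply_eq_mul P.colPlus P.colPlus_injective z₀ P.z (u : IwasawaAlgebra p)).mpr hu
  rw [lengthAt_contra_fine_eq_lengthAt_quotient_of_plusMCEtaKMuPart hp K₀ η hη hη1 V hCM hgood hap hf ϖ hϖ κ γ
      hκ hγ hγK hvar W I FB P hF hμ Y 𝔮 h𝔮]
  exact (lengthAt_quotient_span_eq_of_eq_units_smul_H I hz 𝔮).symm

/-- **Keyed to the registered ROUTE-CRUX stub 6a `PlusMCEtaK` (item 19501) instead of its `μ`-part** (19501 ⟹ 19865 pointwise by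
the kernel `μ`-criterion `PlusMCEtaKUpToMu.plusMCEtaK_iff_muInvariant_eq_of_burungaleTian`, granted 19867): stub 2b's sentence at
`(κ, γ, I, z₀, Y, (p))` ⟺ `length_(p) (Λ ⧸ (P.colPlus z₀)) = length_(p) (Λ ⧸ (P.colPlus P.z))`.
[cite: Kobayashi2003, proof of Thm. 7.4 (p. 13)] [cite: BurungaleTian2026, Thm. 2.6 and Rem. 2.7 (p. 5)] -/
theorem stub2b_sentence_iff_lengthAt_colPlus_of_plusMCEtaK (hF : PublishedInputsEtaUpToP) (hK6 : PlusMCEtaK)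
    (Y : W.FineSelmerDualData κ γ⁻¹) {z₀ : I.H} (h₀ : IsAdmissibleZetaClass W p κ hκ I z₀)
    (𝔮 : PrimeSpectrum (IwasawaAlgebra p)) (h𝔮 : 𝔮.asIdeal = IwasawaAlgebra.augIdealP p) :
    Module.lengthAt (IwasawaAlgebra p) Y.X 𝔮 =
        Module.lengthAt (IwasawaAlgebra p) (I.H ⧸ (IwasawaAlgebra p) ∙ z₀) 𝔮 ↔
      Module.lengthAt (IwasawaAlgebra p) (IwasawaAlgebra p ⧸ Ideal.span {P.colPlus z₀}) 𝔮 =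
        Module.lengthAt (IwasawaAlgebra p) (IwasawaAlgebra p ⧸ Ideal.span {P.colPlus P.z}) 𝔮 := by
  have hμ : PlusMCEtaKMuPart := by
    intro p _ hp K₀ _ _ _ _ η hη hη1 V _ _ N _ f hCM hgood hap hf ϖ hϖ κ γ hκ hγ hγK hvar Lp hLp D
    exact (PlusMCEtaKUpToMu.plusMCEtaK_iff_muInvariant_eq_of_burungaleTian hF.1 hF.2 p hp K₀ η hη hη1 V hCM
      hgood hap hf ϖ hϖ κ γ hκ hγ hγK hvar Lp hLp D).mp
      (hK6 p hp K₀ η hη hη1 V hCM hgood hap hf ϖ hϖ κ γ hκ hγ hγK hvar Lp hLp D)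
  exact stub2b_sentence_iff_lengthAt_colPlus_of_plusMCEtaKMuPart hp K₀ η hη hη1 V hCM hgood hap hf ϖ hϖ κ γ hκ hγ
    hγK hvar W I FB P hF hμ Y h₀ 𝔮 h𝔮

end Frame

end Summit.BirchSwinnertonDyer.BirchSwinnertonDyer.Theorems.CccOneCollinearMu

end
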